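import Summits.CriticalPhenomena.PercolationContinuityZ3.Theorems.Transplant.FKConnectivityAllQAntipodalRootFormAttachP

/-!
# Connectivity correlation inequalities for `φ_{w,q}`, every `q > 0` — ROOT-FORM CALCULUS, file 61w: GENERAL SERIES ATTACHMENT of a
# special-free box (`B · 𝓔`): the five facts pass from `𝓔` to `B · 𝓔`

Support file (`--supports stmt-CriticalPhenomena-4575`), FK sub-lane `prim-bschramm-fk-2` (gen 29); builds on p205010 (kernel theorem,
internal audit signed; external expert review pending).  Definitions `scomb`, `attS`; no named facts, no sorries; standard axioms.  Memo
FROM-fk-2-g28-ROOT-FORM.md §3 (series attachments, (SQ) general) in functional form.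

`attS B 𝓔`: an abstract special-free box `B` (poles `a, m`) in series with a two-special environment `𝓔` (poles `m, b`): levels add, the
poles `a, b` are joined in a replica iff both parts join their poles there.  By kind of the box configuration: `(1,1)` = `𝓔` itself (level
shifted), `(0,0)` = both replicas cut (every slot is a deleted AND), `(1,0)` / `(0,1)` = the sections of a series EDGE (`serE`); the mixed kinds of
a fixed level regroup (file 61v `regroup`) into one instance of `serE 𝓔` (fact 1), of `parE (serE 𝓔)` (fact 2, the general (SQ): the signed term
of the parallel rule vanishes), or of the nested free AND (facts 4, 5) against aggregate weights whose Bool-monotonicity is Theorem U for `B`.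
`attS_facts`: the five facts of the word theorem pass from `𝓔` to `B · 𝓔`.
[folklore]
-/

noncomputable section

namespace Summit.CriticalPhenomena.PercolationContinuityZ3.Theorems

namespace FK

namespace RootForm

open Finset Base

/-- series gluing of a special-free box datum with a pattern datum: levels add, poles joined iff joined in both parts.
(memo FROM-fk-2-g28-ROOT-FORM §3) -/
def scomb (a : SDat) (d : PDat) : PDat := ⟨a.L + d.lam, a.c && d.k1, a.cb && d.k2⟩

/-- **The environment `B · 𝓔`** of an abstract special-free box in series with a two-special environment. (memo FROM-fk-2-g28-ROOT-FORM §3) -/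
def attS {BB C : Type*} (B : BB → SDat) (E : Env C) : Env (BB × C) := fun p =>
  ⟨scomb (B p.1) (E p.2).d0, scomb (B p.1) (E p.2).dy, scomb (B p.1) (E p.2).dz, scomb (B p.1) (E p.2).dyz⟩

section Pointwise

variable (a : SDat)

/-- kind `(1,1)`: the box is invisible up to its level. [folklore] -/
theorem scomb_of_kind11 (d : PDat) (hc : a.c = true) (hcb : a.cb = true) : scomb a d = ⟨d.lam + a.L, d.k1, d.k2⟩ := by
  obtain ⟨L, c, cb⟩ := a; cases hc; cases hcb; simp [scomb]; ring
/-- kind `(1,0)`: a series edge in replica 1. [folklore] -/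
theorem scomb_of_kind10 (d : PDat) (hc : a.c = true) (hcb : a.cb = false) :
    scomb a d = ⟨(d.ser true).lam + a.L, (d.ser true).k1, (d.ser true).k2⟩ := by
  obtain ⟨L, c, cb⟩ := a; cases hc; cases hcb; simp [scomb, PDat.ser]; ring
/-- kind `(0,1)`: a series edge in replica 2. [folklore] -/
theorem scomb_of_kind01 (d : PDat) (hc : a.c = false) (hcb : a.cb = true) :
    scomb a d = ⟨(d.ser false).lam + a.L, (d.ser false).k1, (d.ser false).k2⟩ := by
  obtain ⟨L, c, cb⟩ := a; cases hc; cases hcb; simp [scomb, PDat.ser]; ring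
/-- kind `(0,0)`: both replicas cut. [folklore] -/
theorem scomb_of_kind00 (d : PDat) (hc : a.c = false) (hcb : a.cb = false) :
    scomb a d = ⟨((d.ser false).ser true).lam + a.L, ((d.ser false).ser true).k1, ((d.ser false).ser true).k2⟩ := by
  obtain ⟨L, c, cb⟩ := a; cases hc; cases hcb; simp [scomb, PDat.ser]; ring

/-- `g ∥ (B · 𝓔)`: the parallel edge commutes with the series gluing datum by datum in the same four kinds. [folklore] -/
theorem scomb_par_of_kind (d : PDat) (b : Bool) :
    (a.c = true → a.cb = true → (scomb a d).par b = ⟨(d.par b).lam + a.L, (d.par b).k1, (d.par b).k2⟩) ∧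
    (a.c = true → a.cb = false → (scomb a d).par b = ⟨((d.ser true).par b).lam + a.L, ((d.ser true).par b).k1, ((d.ser true).par b).k2⟩) ∧
    (a.c = false → a.cb = true → (scomb a d).par b = ⟨((d.ser false).par b).lam + a.L, ((d.ser false).par b).k1, ((d.ser false).par b).k2⟩) ∧
    (a.c = false → a.cb = false →
      (scomb a d).par b = ⟨(((d.ser false).ser true).par b).lam + a.L, (((d.ser false).ser true).par b).k1, (((d.ser false).ser true).par b).k2⟩) := by
  obtain ⟨L, c, cb⟩ := a; obtain ⟨l, k1, k2⟩ := d
  refine ⟨fun hc hcb => ?_, fun hc hcb => ?_, fun hc hcb => ?_, fun hc hcb => ?_⟩ <;> cases hc <;> cases hcb <;>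
    cases b <;> cases k1 <;> cases k2 <;> simp [scomb, PDat.ser, PDat.par] <;> ring

end Pointwise

section Facts

variable {BB C : Type*} [Fintype BB] [Preorder BB] [Fintype C] [Preorder C] (B : BB → SDat) (E : Env C)

omit [Fintype BB] [Preorder BB] [Fintype C] [Preorder C] in
set_option linter.unusedSimpArgs false in
/-- **Pointwise decomposition of the integrand of `B · 𝓔` by kind.** [folklore] -/
theorem attS_integrand_kind (H0 H1 : BB × C → ℝ) (J : ℤ) (β : BB) (γ : C) :
    H1 (β, γ) * (attS B E (β, γ)).slot1 J + H0 (β, γ) * (attS B E (β, γ)).slot0 J =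
      kd (B β) true true * (H1 (β, γ) * (E γ).slot1 (J - (B β).L) + H0 (β, γ) * (E γ).slot0 (J - (B β).L))
      + kd (B β) false false * ((H1 (β, γ) + H0 (β, γ)) * (E γ).andDel (J - (B β).L))
      + kd (B β) true false * (H1 (β, γ) * (serE E (true, γ)).slot1 (J - (B β).L) + H0 (β, γ) * (serE E (true, γ)).slot0 (J - (B β).L))
      + kd (B β) false true * (H1 (β, γ) * (serE E (false, γ)).slot1 (J - (B β).L) + H0 (β, γ) * (serE E (false, γ)).slot0 (J - (B β).L)) := by
  cases hc : (B β).c <;> cases hcb : (B β).cb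
  · have h := integrands_of_addLam (serE (serE E) (true, (false, γ))) (attS B E (β, γ)) (B β).L (scomb_of_kind00 _ _ hc hcb)
      (scomb_of_kind00 _ _ hc hcb) (scomb_of_kind00 _ _ hc hcb) (scomb_of_kind00 _ _ hc hcb) J
    rw [h.1, h.2.1]
    simp only [serE, EDat.slot1_ser_true, EDat.slot0_ser_true, EDat.slot1_ser_false, EDat.andDel_ser, kd, hc, hcb, Bool.true_eq_false,
      Bool.false_eq_true, and_self, and_true, and_false, true_and, false_and, if_true, if_false]; ring
  · have h := integrands_of_addLam (serE E (false, γ)) (attS B E (β, γ)) (B β).L (scomb_of_kind01 _ _ hc hcb)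
      (scomb_of_kind01 _ _ hc hcb) (scomb_of_kind01 _ _ hc hcb) (scomb_of_kind01 _ _ hc hcb) J
    rw [h.1, h.2.1]
    simp only [kd, hc, hcb, Bool.true_eq_false, Bool.false_eq_true, and_self, and_true, and_false, true_and, false_and, if_true,
      if_false]; ring
  · have h := integrands_of_addLam (serE E (true, γ)) (attS B E (β, γ)) (B β).L (scomb_of_kind10 _ _ hc hcb)
      (scomb_of_kind10 _ _ hc hcb) (scomb_of_kind10 _ _ hc hcb) (scomb_of_kind10 _ _ hc hcb) J
    rw [h.1, h.2.1]
    simp only [kd, hc, hcb, Bool.true_eq_false, Bool.false_eq_true, and_self, and_true, and_false, true_and, false_and, if_true,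
      if_false]; ring
  · have h := integrands_of_addLam (E γ) (attS B E (β, γ)) (B β).L (scomb_of_kind11 _ _ hc hcb)
      (scomb_of_kind11 _ _ hc hcb) (scomb_of_kind11 _ _ hc hcb) (scomb_of_kind11 _ _ hc hcb) J
    rw [h.1, h.2.1]
    simp only [kd, hc, hcb, Bool.true_eq_false, Bool.false_eq_true, and_self, and_true, and_false, true_and, false_and, if_true,
      if_false]; ring

/-- **Fact 1 for `B · 𝓔`.** [folklore] -/
theorem attS_Mt_nonneg
    (hU : ∀ h : BB → ℝ, Monotone h → (∀ β, 0 ≤ h β) → ∀ K : ℤ,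
      0 ≤ ∑ β, h β * ((if (B β).L = K then (1 : ℝ) else 0) * (kd (B β) true false - kd (B β) false true)))
    (f1 : ∀ h0 h1 : C → ℝ, Monotone h0 → Monotone h1 → (∀ γ, 0 ≤ h0 γ) → (∀ γ, h0 γ ≤ h1 γ) → ∀ J : ℤ, 0 ≤ Mt E h0 h1 J)
    (f3 : ∀ h : C → ℝ, Monotone h → (∀ γ, 0 ≤ h γ) → ∀ J : ℤ, 0 ≤ ∑ γ, h γ * (E γ).andDel J)
    {H0 H1 : BB × C → ℝ} (m0 : Monotone H0) (m1 : Monotone H1) (n0 : ∀ p, 0 ≤ H0 p) (le : ∀ p, H0 p ≤ H1 p) (J : ℤ) :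
    0 ≤ Mt (attS B E) H0 H1 J := by
  have n1 : ∀ p, 0 ≤ H1 p := fun p => (n0 p).trans (le p)
  have R := regroup B H0 H1 (fun γ J => (serE E (true, γ)).slot1 J) (fun γ J => (serE E (true, γ)).slot0 J)
    (fun γ J => (serE E (false, γ)).slot1 J) (fun γ J => (serE E (false, γ)).slot0 J) J
  have RM : ∀ K, ∑ γ, (aggW B K H1 (true, γ) * (serE E (true, γ)).slot1 (J - K) + aggW B K H0 (true, γ) * (serE E (true, γ)).slot0 (J - K)
      + (aggW B K H1 (false, γ) * (serE E (false, γ)).slot1 (J - K) + aggW B K H0 (false, γ) * (serE E (false, γ)).slot0 (J - K))) =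
      Mt (serE E) (aggW B K H0) (aggW B K H1) (J - K) := fun K => by
    unfold Mt; rw [sum_bool_prod, ← Finset.sum_add_distrib]
  unfold Mt
  rw [Fintype.sum_prod_type]
  simp_rw [attS_integrand_kind B E H0 H1 J]
  simp only [Finset.sum_add_distrib]
  rw [add_assoc, R]
  refine add_nonneg (add_nonneg (Finset.sum_nonneg fun β _ => ?_) (Finset.sum_nonneg fun β _ => ?_)) (Finset.sum_nonneg fun K _ => ?_)
  · rw [← Finset.mul_sum]
    exact mul_nonneg (kd_nonneg _ _ _) (f1 _ _ (mono_right m0 β) (mono_right m1 β) (fun γ => n0 _) (fun γ => le _) _)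
  · rw [← Finset.mul_sum]
    exact mul_nonneg (kd_nonneg _ _ _) (f3 _ ((mono_right m1 β).add (mono_right m0 β)) (fun γ => add_nonneg (n1 _) (n0 _)) _)
  · rw [RM]
    exact Mt_ser_nonneg f1 f3 (aggW_mono B hU m0 n0 K) (aggW_mono B hU m1 n1 K) (aggW_nonneg B n0 K) (aggW_le B le K) _

omit [Fintype BB] [Preorder BB] [Fintype C] [Preorder C] in
/-- **Deleted AND of `B · 𝓔`**: every kind is the deleted AND of `𝓔`. [folklore] -/
theorem andDel_attS (β : BB) (γ : C) (J : ℤ) : (attS B E (β, γ)).andDel J = (E γ).andDel (J - (B β).L) := by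
  have h : ∀ d : PDat, (scomb (B β) d).adel J = d.adel (J - (B β).L) := fun d => ind_congr (by simp only [scomb]; omega)
  simp only [EDat.andDel, attS, h]

omit [Fintype BB] [Preorder BB] [Fintype C] [Preorder C] in
/-- **Contracted AND of `B · 𝓔` by kind.** [folklore] -/
theorem andCon_attS (β : BB) (γ : C) (J : ℤ) :
    (attS B E (β, γ)).andCon J = kd (B β) true true * (E γ).andCon (J - (B β).L) + kd (B β) false false * (E γ).andDel (J - (B β).L)
      + kd (B β) true false * (E γ).andE1 (J - (B β).L) + kd (B β) false true * (E γ).andE2 (J - (B β).L) := by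
  have h : ∀ d : PDat, (scomb (B β) d).acon J = kd (B β) true true * d.acon (J - (B β).L) + kd (B β) false false * d.adel (J - (B β).L)
      + kd (B β) true false * d.a1 (J - (B β).L) + kd (B β) false true * d.a2 (J - (B β).L) := fun d => by
    obtain ⟨L, c, cb⟩ := B β; obtain ⟨l, k1, k2⟩ := d
    cases c <;> cases cb <;> cases k1 <;> cases k2 <;> simp [scomb, kd, PDat.adel, PDat.acon, PDat.a1, PDat.a2] <;>
      first | rfl | exact ind_congr (by omega)
  simp only [EDat.andDel, EDat.andCon, EDat.andE1, EDat.andE2, attS, h]; ring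

omit [Fintype BB] [Preorder BB] [Fintype C] [Preorder C] in
/-- **Free nested AND of `B · 𝓔` by kind.** [folklore] -/
theorem andE_attS (β : BB) (γ : C) (J : ℤ) :
    (attS B E (β, γ)).andE1 J = kd (B β) true true * (E γ).andE1 (J - (B β).L) + kd (B β) false false * (E γ).andDel (J - (B β).L)
      + kd (B β) true false * (E γ).andE1 (J - (B β).L) + kd (B β) false true * (E γ).andDel (J - (B β).L) ∧
    (attS B E (β, γ)).andE2 J = kd (B β) true true * (E γ).andE2 (J - (B β).L) + kd (B β) false false * (E γ).andDel (J - (B β).L)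
      + kd (B β) true false * (E γ).andDel (J - (B β).L) + kd (B β) false true * (E γ).andE2 (J - (B β).L) := by
  have h1 : ∀ d : PDat, (scomb (B β) d).a1 J = kd (B β) true true * d.a1 (J - (B β).L) + kd (B β) false false * d.adel (J - (B β).L)
      + kd (B β) true false * d.a1 (J - (B β).L) + kd (B β) false true * d.adel (J - (B β).L) := fun d => by
    obtain ⟨L, c, cb⟩ := B β; obtain ⟨l, k1, k2⟩ := d
    cases c <;> cases cb <;> cases k1 <;> cases k2 <;> simp [scomb, kd, PDat.adel, PDat.a1] <;> exact ind_congr (by omega)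
  have h2 : ∀ d : PDat, (scomb (B β) d).a2 J = kd (B β) true true * d.a2 (J - (B β).L) + kd (B β) false false * d.adel (J - (B β).L)
      + kd (B β) true false * d.adel (J - (B β).L) + kd (B β) false true * d.a2 (J - (B β).L) := fun d => by
    obtain ⟨L, c, cb⟩ := B β; obtain ⟨l, k1, k2⟩ := d
    cases c <;> cases cb <;> cases k1 <;> cases k2 <;> simp [scomb, kd, PDat.adel, PDat.a2] <;> exact ind_congr (by omega)
  simp only [EDat.andE1, EDat.andE2, EDat.andDel, attS, h1, h2]; constructor <;> ring

/-- **Fact 3 for `B · 𝓔`.** [folklore] -/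
theorem attS_andDel_nonneg (f3 : ∀ h : C → ℝ, Monotone h → (∀ γ, 0 ≤ h γ) → ∀ J : ℤ, 0 ≤ ∑ γ, h γ * (E γ).andDel J)
    (h : BB × C → ℝ) (mh : Monotone h) (nh : ∀ p, 0 ≤ h p) (J : ℤ) : 0 ≤ ∑ p, h p * (attS B E p).andDel J := by
  rw [Fintype.sum_prod_type]
  refine Finset.sum_nonneg fun β _ => ?_
  simp only [andDel_attS]
  exact f3 _ (mono_right mh β) (fun γ => nh _) _

/-- **Fact 4 for `B · 𝓔`.** [folklore] -/
theorem attS_andCon_nonneg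
    (hU : ∀ h : BB → ℝ, Monotone h → (∀ β, 0 ≤ h β) → ∀ K : ℤ,
      0 ≤ ∑ β, h β * ((if (B β).L = K then (1 : ℝ) else 0) * (kd (B β) true false - kd (B β) false true)))
    (f3 : ∀ h : C → ℝ, Monotone h → (∀ γ, 0 ≤ h γ) → ∀ J : ℤ, 0 ≤ ∑ γ, h γ * (E γ).andDel J)
    (f4 : ∀ h : C → ℝ, Monotone h → (∀ γ, 0 ≤ h γ) → ∀ J : ℤ, 0 ≤ ∑ γ, h γ * (E γ).andCon J)
    (f5 : ∀ h0 h1 : C → ℝ, Monotone h0 → Monotone h1 → (∀ γ, 0 ≤ h0 γ) → (∀ γ, h0 γ ≤ h1 γ) → ∀ J : ℤ,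
      0 ≤ ∑ γ, (h1 γ * (E γ).andE1 J + h0 γ * (E γ).andE2 J))
    (h : BB × C → ℝ) (mh : Monotone h) (nh : ∀ p, 0 ≤ h p) (J : ℤ) : 0 ≤ ∑ p, h p * (attS B E p).andCon J := by
  have R := regroup B h h (fun γ J => (E γ).andE1 J) (fun _ _ => 0) (fun _ _ => 0) (fun γ J => (E γ).andE2 J) J
  simp only [mul_zero, add_zero, zero_add] at R
  have hsplit : ∑ p, h p * (attS B E p).andCon J =
      ∑ β, ∑ γ, kd (B β) true true * (h (β, γ) * (E γ).andCon (J - (B β).L))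
      + ∑ β, ∑ γ, kd (B β) false false * (h (β, γ) * (E γ).andDel (J - (B β).L))
      + (∑ β, ∑ γ, kd (B β) true false * (h (β, γ) * (E γ).andE1 (J - (B β).L))
        + ∑ β, ∑ γ, kd (B β) false true * (h (β, γ) * (E γ).andE2 (J - (B β).L))) := by
    rw [Fintype.sum_prod_type]
    simp only [andCon_attS, ← Finset.sum_add_distrib]
    exact Finset.sum_congr rfl fun β _ => Finset.sum_congr rfl fun γ _ => by ring
  rw [hsplit, R]
  refine add_nonneg (add_nonneg (Finset.sum_nonneg fun β _ => ?_) (Finset.sum_nonneg fun β _ => ?_)) (Finset.sum_nonneg fun K _ => ?_)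
  · rw [← Finset.mul_sum]; exact mul_nonneg (kd_nonneg _ _ _) (f4 _ (mono_right mh β) (fun γ => nh _) _)
  · rw [← Finset.mul_sum]; exact mul_nonneg (kd_nonneg _ _ _) (f3 _ (mono_right mh β) (fun γ => nh _) _)
  · have hm := aggW_mono B hU mh nh K
    exact f5 _ _ (mono_sec hm false) (mono_sec hm true) (fun γ => aggW_nonneg B nh K _) (fun γ => sec_le hm γ) _

/-- **Fact 5 for `B · 𝓔`.** [folklore] -/
theorem attS_andFree_nonneg
    (hU : ∀ h : BB → ℝ, Monotone h → (∀ β, 0 ≤ h β) → ∀ K : ℤ,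
      0 ≤ ∑ β, h β * ((if (B β).L = K then (1 : ℝ) else 0) * (kd (B β) true false - kd (B β) false true)))
    (f3 : ∀ h : C → ℝ, Monotone h → (∀ γ, 0 ≤ h γ) → ∀ J : ℤ, 0 ≤ ∑ γ, h γ * (E γ).andDel J)
    (f5 : ∀ h0 h1 : C → ℝ, Monotone h0 → Monotone h1 → (∀ γ, 0 ≤ h0 γ) → (∀ γ, h0 γ ≤ h1 γ) → ∀ J : ℤ,
      0 ≤ ∑ γ, (h1 γ * (E γ).andE1 J + h0 γ * (E γ).andE2 J))
    (h0 h1 : BB × C → ℝ) (m0 : Monotone h0) (m1 : Monotone h1) (n0 : ∀ p, 0 ≤ h0 p) (le : ∀ p, h0 p ≤ h1 p) (J : ℤ) :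
    0 ≤ ∑ p, (h1 p * (attS B E p).andE1 J + h0 p * (attS B E p).andE2 J) := by
  have n1 : ∀ p, 0 ≤ h1 p := fun p => (n0 p).trans (le p)
  have R := regroup B h0 h1 (fun γ J => (E γ).andE1 J) (fun _ _ => 0) (fun _ _ => 0) (fun γ J => (E γ).andE2 J) J
  simp only [mul_zero, add_zero, zero_add] at R
  have hsplit : ∑ p, (h1 p * (attS B E p).andE1 J + h0 p * (attS B E p).andE2 J) =
      ∑ β, ∑ γ, kd (B β) true true * (h1 (β, γ) * (E γ).andE1 (J - (B β).L) + h0 (β, γ) * (E γ).andE2 (J - (B β).L))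
      + ∑ β, ∑ γ, kd (B β) false false * ((h1 (β, γ) + h0 (β, γ)) * (E γ).andDel (J - (B β).L))
      + ∑ β, ∑ γ, (kd (B β) true false * h0 (β, γ) + kd (B β) false true * h1 (β, γ)) * (E γ).andDel (J - (B β).L)
      + (∑ β, ∑ γ, kd (B β) true false * (h1 (β, γ) * (E γ).andE1 (J - (B β).L))
        + ∑ β, ∑ γ, kd (B β) false true * (h0 (β, γ) * (E γ).andE2 (J - (B β).L))) := by
    rw [Fintype.sum_prod_type]
    simp only [← Finset.sum_add_distrib]
    refine Finset.sum_congr rfl fun β _ => Finset.sum_congr rfl fun γ _ => ?_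
    obtain ⟨e1, e2⟩ := andE_attS B E β γ J
    rw [e1, e2]; ring
  rw [hsplit, R]
  refine add_nonneg (add_nonneg (add_nonneg (Finset.sum_nonneg fun β _ => ?_) (Finset.sum_nonneg fun β _ => ?_))
    (Finset.sum_nonneg fun β _ => ?_)) (Finset.sum_nonneg fun K _ => ?_)
  · rw [← Finset.mul_sum]
    exact mul_nonneg (kd_nonneg _ _ _) (f5 _ _ (mono_right m0 β) (mono_right m1 β) (fun γ => n0 _) (fun γ => le _) _)
  · rw [← Finset.mul_sum]
    exact mul_nonneg (kd_nonneg _ _ _) (f3 _ ((mono_right m1 β).add (mono_right m0 β)) (fun γ => add_nonneg (n1 _) (n0 _)) _)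
  · exact f3 _ (((mono_right m0 β).const_mul (kd_nonneg _ _ _)).add ((mono_right m1 β).const_mul (kd_nonneg _ _ _)))
      (fun γ => add_nonneg (mul_nonneg (kd_nonneg _ _ _) (n0 _)) (mul_nonneg (kd_nonneg _ _ _) (n1 _))) _
  · have hm0 := aggW_mono B hU m0 n0 K
    have hm1 := aggW_mono B hU m1 n1 K
    exact f5 _ _ (mono_sec hm0 false) (mono_sec hm1 true) (fun γ => aggW_nonneg B n0 K _)
      (fun γ => (sec_le hm0 γ).trans (aggW_le B le K _)) _

end Facts

end RootForm

end FK

end Summit.CriticalPhenomena.PercolationContinuityZ3.Theorems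

end
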